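import Summits.QuantumFields.BalabanUV.T4Continuum.Support.NE3CompetitorNestedFix
import Summits.QuantumFields.BalabanUV.T4Continuum.Support.NE3TopRadiusLetters
import Summits.QuantumFields.BalabanUV.T4Continuum.Support.NE3BlockLineAverage
import Summits.QuantumFields.BalabanUV.T4Continuum.Support.NE3CurvedCornerGaugeSpace
import Summits.QuantumFields.BalabanUV.T4Continuum.Support.NE3SlicePoincareCompetitorEnergy
import Summits.QuantumFields.BalabanUV.T4Continuum.Support.NE3CovariantCompetitorValue
import Summits.QuantumFields.BalabanUV.T4Continuum.Spine.NE3.LandauProjectionB8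
import Mathlib.Algebra.Order.Chebyshev
import HarnessLib

/-!
# T⁴ programme, node NE3 — census R40 (file (ii)a): THE NESTED-MEAN FIX TOWARDS `N(Q′(W))` — block bounds for the nested transported mean and
# the dressed-bump corrector `ψ = nfixW 0 (Q′φ)` (skew, periodic, `φ − ψ ∈ N`, small energy, small sup) at a curved background of the class

Cell `pub-balaban-gaps` (YM blitz, track G2, seat `ne3`, unit `pub-balaban-gaps-ne3-g9`; writer prover-pub-balaban-gaps-ne3-g9-0, 2026-08-24, over
the gen-8 draft), census `run/shared/lean/pub/pub-balaban-gaps/ne/NE3.md` §4 R40.  WHY.  (HR_W) — the `ℓ^∞` bound of B8's (1.38)-projection onto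
`Δ_W N(Q′(W))` — is the last analytic input of THE END's sup letter `hK` at a curved background (gen 8, `LandauCorrectionSupB8Cavg`).  R38 did it at
`W = 1` through «`Δ_1 g` is block-constant» + an inverse inequality against a bump.  At a curved `W` we never spell out `N^⊥`: both inverse
inequalities of the companion `LandauProjectionCurvedCore` follow from ONE device, proved here — for every skew `P`-periodic `φ` the NESTED-MEAN FIX
`ψ = nfixW 0 (Q′φ)` of the K5 road (`NE3CompetitorNestedFix`: a dressed bump with `Q′(W)ψ = Q′φ` EXACTLY) — so that `φ − ψ ∈ N(Q′(W))`:

* §0 **`sum_hsR_covLapSite_symm`** (`Δ_W` is `hsR`-symmetric over the period box, any unitary periodic `W`; the flat case is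
  `FlatBlockHarmonicInverse.sum_hsR_covLapSite_comm`).
* §1 **`norm_bmeanIterW_le`** — `‖Q′ξ(z)‖ ≤ (3∕2)·M^{−d}Σ_{block z}‖ξ‖` (J2 bridge `norm_bmeanIterW_sub_bmeanW_le` with `E_j ≤ 1∕2` from `LevelSmall`,
  + Jensen for the single-scale mean), its `ℓ²` forms `normSq_bmeanIterW_le`, `sum_normSq_bmeanIterW_le` (`Σ_z‖Q′ξ z‖² ≤ (9∕4)M^{−d}Σ_y‖ξ y‖²`).
* §2 **`exists_fix`** — for every skew `P`-periodic `φ` (`P = N·M`, `M = L^{j+1}`): `ψ := nfixW 0 (Q′φ)` is skew, `P`-periodic, `φ − ψ ∈ N`, with energy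
  `ΣΣ‖D_Wψ‖² ≤ 2dM^d(1∕M + 2(d−1)(M−1)x)²(2∕tentMean)²·Σ_z‖Q′φ z‖²` and sup `‖ψ y‖ ≤ (2∕tentMean)‖Q′φ(blk M y)‖`.
* §3 `sum_block_delta_le` — a `P`-periodic delta meets each `M`-block at most once (`M ≤ P`).

HONEST: lattice linear algebra at one background of the multi-level small-field class (`L ≥ 2`, `LevelSmall`, `SmallField W x`); 0 sorry; no `def`;
nothing of Bałaban's asserted; `hK`∕(P♮) at curved `W`, `PairLandauGaugeB8Avg`, the covariant root and **NE3 are NOT proved**; spine PROVED 0∕9;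
finite T⁴ rung (B)+1 — NOT infinite volume, NOT mass gap, NOT `BetaPertH`, NOT Clay.  PLACEMENT: `Summits/QuantumFields/BalabanUV/T4Continuum/Spine/NE3/`;
imports accepted modules only; moves nothing.  HONEST DEPENDENCY (cell page 1): continuum YM on T⁴ ⇐ BetaPertH ∧ nine spine estimates (0/9 proved);
BetaPertH ⇐ (D1) ∧ (D4) ∧ CAP+tail.
-/

set_option autoImplicit false

open scoped BigOperators Matrix Matrix.Norms.L2Operator
open NormedSpace Finset

namespace Summit.QuantumFields.BalabanUV.T4Continuum.NE3.LandauProjectionCurvedFix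

open Literature.MathematicalPhysics.QuantumFieldTheory.Balaban1983to89
open B7Prop1Explicit B7Prop2Explicit MatrixNorms
open T4AveragingDeficitWall (Ad IsUnitaryCfg IsSkewDir SmallField)
open T4AveragingDeficitWallBoundary (IsPeriodicCfg periodBox mem_periodBox card_periodBox)
open AveragingDeficitPeriodicCounting (IsPeriodicDir)
open AveragingDeficitMultiLevelPrep (LevelSmall tower)
open AveragingDeficitTorusChart (periodic_smul_vec)
open AveragingDeficitTransport (norm_Ad_of_unitary)
open AveragingDeficitBlockDensity (btree btree_mem)
open BlockAveragePushDirGauge (gaugeDir isPeriodicDir_gaugeDir)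
open SmoothRefineBlocks (blk)
open SkeletonLattice (cdiv cmod smul_cdiv_add_cmod cmod_nonneg cmod_lt cmod_eq_of_repr cmod_add_period)
open SpreadLift (loopRad)
open AveragingDeficitTwoLevelPrep (prop1Radius)
open NE3CovariantCalculus (hsR hsR_self hsR_comm hsR_sub_right nhsNormSq_sub abs_hsR_le)
open NE3CovariantSBound (abs_hsR_le_nhsNorm)
open NE3CovariantWeitzenbock (covDiv)
open NE3CovariantBlockMean (bmeanW bmeanIterW)
open NE3TentBump (bump tent tent_nonneg tent_le_one)
open NE3DressedBlockField (dressW)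
open NE3CovariantCompetitorValue (norm_dressW_bump_le)
open NE3NestedMeanBlockOperator (tentMean tentMean_pos inv_le_tentMean bmeanIterW_add_period' star_bmeanIterW dressW_bump_block)
open NE3NestedBlockMeanCovariance (norm_bmeanW_le_mean)
open NE3NestedBlockMeanBridge (norm_bmeanIterW_sub_bmeanW_le)
open NE3TopRadiusLetters (E_le_half_of_levelSmall)
open NE3BlockLineAverage (sum_univ_boxVec sum_periodBox_blocks)
open NE3FrameFreeSliceW (bmeanIterW_add bmeanIterW_zero' bmeanIterW_smul)
open NE3SlicePoincareCompetitorEnergy (bmeanIterW_sub')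
open NE3CompetitorNestedFix (nfixCoef norm_nfixCoef_le nfixW bmeanIterW_nfixW nfixW_mem_skewAdjoint nfixW_add_period sum_normSq_gaugeDir_nfixW_le)
open NE3LandauOrbit (sum_hsR_gaugeDir gaugeDir_skew hsR_zero_right)
open NE3CurvedCornerGaugeSpace (covDiv_mem_skewAdjoint)
open NE3CurvedProjectedLandau (tower_eq_pow_mul)
open NE3CovariantLineSumsError (iterate_prop1Radius_nonneg)
open NE3.PairLandauB8 (avgKernelGauges covLapSite mem_avgKernelGauges_iff)
open NE3.LandauProjectionB8 (covDiv_gaugeDir_eq_covLapSite covLapSite_add_period sum_nhsNormSq_gaugeDir_eq)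

noncomputable section

variable {d : ℕ} {n : Type*} [Fintype n] [DecidableEq n]

/-! ## §0 `Δ_W` is `hsR`-symmetric -/

/-- **`Δ_W` IS `hsR`-SYMMETRIC OVER THE PERIOD BOX** (unitary `P`-periodic `W`, `P`-periodic `f`, `g`): `Σ hsR (Δ_W f) g = Σ hsR f (Δ_W g)` — both equal
`Σ Σ_κ hsR (D_W f)(D_W g)` (`sum_hsR_gaugeDir`).  The flat case is `FlatBlockHarmonicInverse.sum_hsR_covLapSite_comm`. [folklore] -/
theorem sum_hsR_covLapSite_symm {P : ℕ} (hP : 1 ≤ P) {W : Site d → Fin d → (Matrix n n ℂ)ˣ} (hWu : IsUnitaryCfg W) (hWP : IsPeriodicCfg W (P : ℤ))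
    {f g : Site d → Matrix n n ℂ} (hf : ∀ (y : Site d) (i : Fin d), f (y + (P : ℤ) • e i) = f y) (hg : ∀ (y : Site d) (i : Fin d), g (y + (P : ℤ) • e i) = g y) :
    ∑ y ∈ periodBox (d := d) P, hsR (covLapSite W f y) (g y) = ∑ y ∈ periodBox (d := d) P, hsR (f y) (covLapSite W g y) := by
  have h1 := sum_hsR_gaugeDir hP hWu (isPeriodicDir_gaugeDir hWP hf) hg
  have h2 := sum_hsR_gaugeDir hP hWu (isPeriodicDir_gaugeDir hWP hg) hf
  rw [covDiv_gaugeDir_eq_covLapSite] at h1 h2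
  rw [← h1]
  have h3 : ∑ x ∈ periodBox (d := d) P, ∑ μ : Fin d, hsR (gaugeDir W f x μ) (gaugeDir W g x μ)
      = ∑ x ∈ periodBox (d := d) P, ∑ μ : Fin d, hsR (gaugeDir W g x μ) (gaugeDir W f x μ) :=
    Finset.sum_congr rfl fun x _ => Finset.sum_congr rfl fun μ _ => hsR_comm _ _
  rw [h3, h2]
  exact Finset.sum_congr rfl fun x _ => hsR_comm _ _

/-! ## §1 The nested mean is `ℓ¹`- and `ℓ²`-bounded by the block -/

omit [Fintype n] [DecidableEq n] in
/-- Cauchy–Schwarz on a block: `(Σ_{v∈[0,M)^d} f v)² ≤ M^d · Σ f²`. [folklore] -/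
theorem sq_sum_periodBox_le (M : ℕ) (f : Site d → ℝ) :
    (∑ v ∈ periodBox (d := d) M, f v) ^ 2 ≤ (M : ℝ) ^ d * ∑ v ∈ periodBox (d := d) M, f v ^ 2 := by
  have h := sq_sum_le_card_mul_sum_sq (s := periodBox (d := d) M) (f := f)
  rw [card_periodBox] at h
  exact_mod_cast h

/-- **THE NESTED MEAN IS BOUNDED BY THE BLOCK `ℓ¹`-MEAN** (multi-level class, `L ≥ 2`): `‖Q′ξ(z)‖ ≤ (3∕2)·M^{−d}·Σ_{v∈[0,M)^d}‖ξ(M•z + v)‖`, `M = L^{j+1}`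
(J2 bridge with `E_j ≤ 1∕2` + Jensen for the single-scale transported mean). [folklore] -/
theorem norm_bmeanIterW_le [Nonempty n] {L : ℕ} (hL : 2 ≤ L) (j : ℕ) {W : Site d → Fin d → (Matrix n n ℂ)ˣ} {x : ℝ}
    (hWu : IsUnitaryCfg W) (hx : 0 ≤ x) (hsm : LevelSmall d L j x) (hWx : SmallField W x) (ξ : Site d → Matrix n n ℂ) (z : Site d) :
    ‖bmeanIterW L (j + 1) W ξ z‖
      ≤ 3 / 2 * ((((L ^ (j + 1) : ℕ) : ℝ) ^ d)⁻¹ * ∑ v ∈ periodBox (d := d) (L ^ (j + 1)), ‖ξ (((L ^ (j + 1) : ℕ) : ℤ) • z + v)‖) := by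
  have hL1 : 1 ≤ L := by omega
  set M : ℕ := L ^ (j + 1) with hM
  set A : ℝ := (((M : ℕ) : ℝ) ^ d)⁻¹ * ∑ v ∈ periodBox (d := d) M, ‖ξ (((M : ℕ) : ℤ) • z + v)‖ with hA
  have hA0 : 0 ≤ A := by positivity
  have hE := E_le_half_of_levelSmall (d := d) hL1 j hx hsm
  have hbridge := norm_bmeanIterW_sub_bmeanW_le hL j hWu hx hsm hWx ξ z
  have hsingle : ‖bmeanW M W ξ z‖ ≤ A := by
    refine (norm_bmeanW_le_mean hWu ξ z).trans (le_of_eq ?_)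
    rw [hA, Finset.mul_sum, ← sum_univ_boxVec M (fun v => ((M : ℝ) ^ d)⁻¹ * ‖ξ (((M : ℕ) : ℤ) • z + v)‖)]
  calc ‖bmeanIterW L (j + 1) W ξ z‖ ≤ ‖bmeanIterW L (j + 1) W ξ z - bmeanW M W ξ z‖ + ‖bmeanW M W ξ z‖ := norm_le_norm_sub_add _ _
    _ ≤ 1 / 2 * A + A := by
        refine add_le_add (hbridge.trans ?_) hsingle
        exact mul_le_mul_of_nonneg_right hE hA0
    _ = 3 / 2 * A := by ring

/-- The `ℓ²` form on one block: `‖Q′ξ(z)‖² ≤ (9∕4)·M^{−d}·Σ_{v}‖ξ(M•z+v)‖²`. [folklore] -/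
theorem normSq_bmeanIterW_le [Nonempty n] {L : ℕ} (hL : 2 ≤ L) (j : ℕ) {W : Site d → Fin d → (Matrix n n ℂ)ˣ} {x : ℝ}
    (hWu : IsUnitaryCfg W) (hx : 0 ≤ x) (hsm : LevelSmall d L j x) (hWx : SmallField W x) (ξ : Site d → Matrix n n ℂ) (z : Site d) :
    ‖bmeanIterW L (j + 1) W ξ z‖ ^ 2
      ≤ 9 / 4 * ((((L ^ (j + 1) : ℕ) : ℝ) ^ d)⁻¹ * ∑ v ∈ periodBox (d := d) (L ^ (j + 1)), ‖ξ (((L ^ (j + 1) : ℕ) : ℤ) • z + v)‖ ^ 2) := by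
  set M : ℕ := L ^ (j + 1) with hM
  have hM0 : (0 : ℝ) < ((M : ℕ) : ℝ) ^ d := by have : 1 ≤ M := Nat.one_le_pow _ _ (by omega); positivity
  have h := norm_bmeanIterW_le hL j hWu hx hsm hWx ξ z
  have h0 : 0 ≤ ‖bmeanIterW L (j + 1) W ξ z‖ := norm_nonneg _
  have hcs := sq_sum_periodBox_le (d := d) M (fun v => ‖ξ (((M : ℕ) : ℤ) • z + v)‖)
  calc ‖bmeanIterW L (j + 1) W ξ z‖ ^ 2
      ≤ (3 / 2 * ((((M : ℕ) : ℝ) ^ d)⁻¹ * ∑ v ∈ periodBox (d := d) M, ‖ξ (((M : ℕ) : ℤ) • z + v)‖)) ^ 2 := pow_le_pow_left₀ h0 h 2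
    _ = 9 / 4 * (((((M : ℕ) : ℝ) ^ d)⁻¹) ^ 2 * (∑ v ∈ periodBox (d := d) M, ‖ξ (((M : ℕ) : ℤ) • z + v)‖) ^ 2) := by ring
    _ ≤ 9 / 4 * (((((M : ℕ) : ℝ) ^ d)⁻¹) ^ 2 * (((M : ℕ) : ℝ) ^ d * ∑ v ∈ periodBox (d := d) M, ‖ξ (((M : ℕ) : ℤ) • z + v)‖ ^ 2)) := by
        gcongr
    _ = 9 / 4 * ((((M : ℕ) : ℝ) ^ d)⁻¹ * ∑ v ∈ periodBox (d := d) M, ‖ξ (((M : ℕ) : ℤ) • z + v)‖ ^ 2) := by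
        field_simp

/-- The `ℓ²` form on the torus: `Σ_{z∈[0,N)^d}‖Q′ξ(z)‖² ≤ (9∕4)·M^{−d}·Σ_{y∈[0,MN)^d}‖ξ y‖²`. [folklore] -/
theorem sum_normSq_bmeanIterW_le [Nonempty n] {L : ℕ} (hL : 2 ≤ L) (j : ℕ) {W : Site d → Fin d → (Matrix n n ℂ)ˣ} {x : ℝ}
    (hWu : IsUnitaryCfg W) (hx : 0 ≤ x) (hsm : LevelSmall d L j x) (hWx : SmallField W x) (ξ : Site d → Matrix n n ℂ) (N : ℕ) :
    ∑ z ∈ periodBox (d := d) N, ‖bmeanIterW L (j + 1) W ξ z‖ ^ 2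
      ≤ 9 / 4 * ((((L ^ (j + 1) : ℕ) : ℝ) ^ d)⁻¹ * ∑ y ∈ periodBox (d := d) (L ^ (j + 1) * N), ‖ξ y‖ ^ 2) := by
  have hM1 : 1 ≤ L ^ (j + 1) := Nat.one_le_pow _ _ (by omega)
  rw [← sum_periodBox_blocks (L ^ (j + 1)) N hM1 (fun y => ‖ξ y‖ ^ 2), Finset.mul_sum, Finset.mul_sum]
  exact Finset.sum_le_sum fun z _ => normSq_bmeanIterW_le hL j hWu hx hsm hWx ξ z

/-! ## §2 The nested-mean fix towards `N(Q′(W))` -/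

section Perp

variable [Nonempty n] {L N : ℕ} (hL : 2 ≤ L) (j : ℕ) {W : Site d → Fin d → (Matrix n n ℂ)ˣ} {x : ℝ}
  (hWu : IsUnitaryCfg W) (hWP : IsPeriodicCfg W ((N * L ^ (j + 1) : ℕ) : ℤ)) (hx : 0 ≤ x) (hsm : LevelSmall d L j x) (hWx : SmallField W x)

include hL hWu hWP hx hsm hWx in
/-- **THE NESTED-MEAN FIX TOWARDS `N(Q′(W))`** (`L ≥ 2`, class at `W`, period `P = N·M`, `M = L^{j+1}`): for every skew `P`-periodic `φ` there is `ψ`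
(`:= nfixW 0 (Q′φ)`, the fix of `0` towards `Q′φ = bmeanIterW L (j+1) W φ`) — skew, `P`-periodic, with **`φ − ψ ∈ N(Q′(W)) = avgKernelGauges L N (j+1) W`**,
of energy `ΣΣ‖D_Wψ‖² ≤ 2dM^d(1∕M + 2(d−1)(M−1)x)²(2∕tentMean)²·Σ_{z∈[0,N)^d}‖Q′φ z‖²` and of sup `‖ψ y‖ ≤ (2∕tentMean)·‖Q′φ (blk M y)‖` (a dressed bump).
[folklore] -/
theorem exists_fix {φ : Site d → Matrix n n ℂ} (hφs : ∀ y, φ y ∈ skewAdjoint (Matrix n n ℂ))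
    (hφP : ∀ (y : Site d) (i : Fin d), φ (y + ((N * L ^ (j + 1) : ℕ) : ℤ) • e i) = φ y) :
    ∃ ψ : Site d → Matrix n n ℂ,
      (∀ y, ψ y ∈ skewAdjoint (Matrix n n ℂ)) ∧
      (∀ (y : Site d) (i : Fin d), ψ (y + ((N * L ^ (j + 1) : ℕ) : ℤ) • e i) = ψ y) ∧
      (fun y => φ y - ψ y) ∈ avgKernelGauges (d := d) (n := n) L N (j + 1) W ∧
      (∑ y ∈ periodBox (d := d) (L ^ (j + 1) * N), ∑ α : Fin d, ‖gaugeDir W ψ y α‖ ^ 2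
        ≤ 2 * ((d : ℝ) * (((L ^ (j + 1) : ℕ) : ℝ)) ^ d
              * (1 / (((L ^ (j + 1) : ℕ) : ℝ)) + 2 * (((d : ℝ) - 1) * ((((L ^ (j + 1) : ℕ) : ℝ)) - 1) * x)) ^ 2)
            * ((2 / tentMean d (L ^ (j + 1))) ^ 2 * ∑ z ∈ periodBox (d := d) N, ‖bmeanIterW L (j + 1) W φ z‖ ^ 2)) ∧
      (∀ y, ‖ψ y‖ ≤ 2 / tentMean d (L ^ (j + 1)) * ‖bmeanIterW L (j + 1) W φ (blk (L ^ (j + 1)) y)‖) := by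
  have hL1 : 1 ≤ L := by omega
  have hM1 : 1 ≤ L ^ (j + 1) := Nat.one_le_pow _ _ hL1
  have hPMN : N * L ^ (j + 1) = L ^ (j + 1) * N := Nat.mul_comm _ _
  have hE := E_le_half_of_levelSmall (d := d) hL1 j hx hsm
  -- the coarse target `t = Q′φ`: skew and `N`-periodic
  have hWPt : IsPeriodicCfg W ((tower L N (j + 1) : ℕ) : ℤ) := by rw [tower_eq_pow_mul, ← hPMN]; exact hWP
  have hφPt : ∀ (y : Site d) (i : Fin d), φ (y + ((tower L N (j + 1) : ℕ) : ℤ) • e i) = φ y := by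
    intro y i; rw [tower_eq_pow_mul, ← hPMN]; exact hφP y i
  have htP : ∀ (z : Site d) (i : Fin d), bmeanIterW L (j + 1) W φ (z + (N : ℤ) • e i) = bmeanIterW L (j + 1) W φ z :=
    fun z i => bmeanIterW_add_period' j hWPt hφPt z i
  have hts : ∀ z, bmeanIterW L (j + 1) W φ z ∈ skewAdjoint (Matrix n n ℂ) := by
    intro z
    rw [skewAdjoint.mem_iff, star_bmeanIterW hL1 j hWu hx hsm hWx φ z]
    have e1 : (fun y => star (φ y)) = (-1 : ℝ) • φ := by
      funext y; rw [Pi.smul_apply, (skewAdjoint.mem_iff.mp (hφs y)), neg_one_smul]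
    rw [e1, bmeanIterW_smul, Pi.smul_apply, neg_one_smul]
  have hψs : ∀ y, nfixW hL j hWu hx hsm hWx hE 0 (bmeanIterW L (j + 1) W φ) y ∈ skewAdjoint (Matrix n n ℂ) :=
    fun y => nfixW_mem_skewAdjoint hL j hWu hx hsm hWx hE (fun _ => (skewAdjoint (Matrix n n ℂ)).zero_mem) hts y
  have hψP : ∀ (y : Site d) (i : Fin d), nfixW hL j hWu hx hsm hWx hE 0 (bmeanIterW L (j + 1) W φ) (y + ((N * L ^ (j + 1) : ℕ) : ℤ) • e i)
      = nfixW hL j hWu hx hsm hWx hE 0 (bmeanIterW L (j + 1) W φ) y := by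
    intro y i
    have h1 := nfixW_add_period hL j hWu hx hsm hWx hE hWPt (F₀ := 0) (t := bmeanIterW L (j + 1) W φ) (fun _ _ => rfl) htP y i
    rw [tower_eq_pow_mul, ← hPMN] at h1
    exact h1
  have hsub : (fun z => bmeanIterW L (j + 1) W φ z - bmeanIterW L (j + 1) W (0 : Site d → Matrix n n ℂ) z) = bmeanIterW L (j + 1) W φ := by
    funext z; rw [bmeanIterW_zero', Pi.zero_apply, sub_zero]
  refine ⟨nfixW hL j hWu hx hsm hWx hE 0 (bmeanIterW L (j + 1) W φ), hψs, hψP, ?_, ?_, ?_⟩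
  · refine mem_avgKernelGauges_iff.mpr ⟨fun y => (skewAdjoint _).sub_mem (hφs y) (hψs y), fun y i => ?_, ?_⟩
    · show φ _ - _ = φ y - _
      rw [hφP y i, hψP y i]
    · funext z
      rw [bmeanIterW_sub' L (j + 1) W φ _ z, bmeanIterW_nfixW, Pi.zero_apply, sub_self]
  · have h1 := sum_normSq_gaugeDir_nfixW_le hL j hWu hx hsm hWx hE N hx hWx (0 : Site d → Matrix n n ℂ) (bmeanIterW L (j + 1) W φ)
    have hzero : ∑ y ∈ periodBox (d := d) (L ^ (j + 1) * N), ∑ α : Fin d, ‖gaugeDir W (0 : Site d → Matrix n n ℂ) y α‖ ^ 2 = 0 := by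
      refine Finset.sum_eq_zero fun y _ => Finset.sum_eq_zero fun α _ => ?_
      simp [gaugeDir, AveragingDeficitNearIdentity.Ad_zero]
    have hsub' : ∀ z, bmeanIterW L (j + 1) W φ z - bmeanIterW L (j + 1) W (0 : Site d → Matrix n n ℂ) z = bmeanIterW L (j + 1) W φ z :=
      fun z => congr_fun hsub z
    simp only [hzero, mul_zero, zero_add, hsub'] at h1
    exact h1
  · intro y
    have e1 : nfixW hL j hWu hx hsm hWx hE 0 (bmeanIterW L (j + 1) W φ) y
        = dressW (L ^ (j + 1)) W (bump (L ^ (j + 1)) (nfixCoef hL j hWu hx hsm hWx hE (bmeanIterW L (j + 1) W φ))) y := by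
      simp only [nfixW, Pi.zero_apply, zero_add, hsub]
    rw [e1]
    exact (norm_dressW_bump_le hM1 hWu _ y).trans (norm_nfixCoef_le hL j hWu hx hsm hWx hE _ _)

end Perp

/-! ## §3 The `ℓ¹ → ℓ^∞` step for `h ⊥ N(Q′(W))` -/

omit [Fintype n] [DecidableEq n] in
/-- **A `P`-PERIODIC DELTA MEETS EACH `M`-BLOCK AT MOST ONCE** (`1 ≤ M ≤ P`): for the indicator-type function `δ y = if cmod P y = q then Y else 0`,
`Σ_{v∈[0,M)^d}‖δ(M•z + v)‖ ≤ ‖Y‖`. [folklore] -/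
theorem sum_block_delta_le {M P : ℕ} (hM : 1 ≤ M) (hMP : M ≤ P) {E : Type*} [SeminormedAddCommGroup E] (Y : E) (q z : Site d) :
    ∑ v ∈ periodBox (d := d) M, ‖(if cmod P (((M : ℕ) : ℤ) • z + v) = q then Y else 0)‖ ≤ ‖Y‖ := by
  classical
  have hP : 1 ≤ P := le_trans hM hMP
  -- two in-block offsets with the same residue mod `P` coincide
  have huniq : ∀ v ∈ periodBox (d := d) M, ∀ v' ∈ periodBox (d := d) M,
      cmod P (((M : ℕ) : ℤ) • z + v) = cmod P (((M : ℕ) : ℤ) • z + v') → v = v' := by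
    intro v hv v' hv' hvv
    have e1 := smul_cdiv_add_cmod P (((M : ℕ) : ℤ) • z + v)
    have e2 := smul_cdiv_add_cmod P (((M : ℕ) : ℤ) • z + v')
    funext i
    have h1 := congr_fun e1 i
    have h2 := congr_fun e2 i
    have h3 := congr_fun hvv i
    simp only [Pi.add_apply, Pi.smul_apply, smul_eq_mul] at h1 h2 h3
    have hvi := (mem_periodBox.1 hv i)
    have hvi' := (mem_periodBox.1 hv' i)
    have hdvd : (P : ℤ) ∣ (v i - v' i) :=
      ⟨cdiv P (((M : ℕ) : ℤ) • z + v) i - cdiv P (((M : ℕ) : ℤ) • z + v') i, by linear_combination h2 - h1 + h3⟩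
    have habs : |v i - v' i| < (P : ℤ) := by
      rw [abs_lt]; constructor <;> omega
    have h0 := Int.eq_zero_of_abs_lt_dvd hdvd habs
    omega
  by_cases hex : ∃ v₀ ∈ periodBox (d := d) M, cmod P (((M : ℕ) : ℤ) • z + v₀) = q
  · obtain ⟨v₀, hv₀, hq⟩ := hex
    rw [Finset.sum_eq_single_of_mem v₀ hv₀]
    · rw [if_pos hq]
    · intro v hv hne
      rw [if_neg, norm_zero]
      intro hv'
      exact hne (huniq v hv v₀ hv₀ (hv'.trans hq.symm))
  · push Not at hex
    rw [Finset.sum_eq_zero fun v hv => by rw [if_neg (hex v hv), norm_zero]]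
    exact norm_nonneg _

end

end Summit.QuantumFields.BalabanUV.T4Continuum.NE3.LandauProjectionCurvedFix
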